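import Mathlib.Algebra.DirectSum.Module
import Mathlib.Algebra.Lie.OfAssociative
import Mathlib.Algebra.Lie.Sl2
import Mathlib.Algebra.Lie.Subalgebra
import Literature.Geometry.Kaehler.LefschetzOperator
import HarnessLib

/-!
# The Looijenga–Lunts–Verbitsky (LLV) Lie algebra of a graded cohomology ring

Layer `Literature/AlgebraicGeometry/Hyperkaehler`. Requested ("desirable alongside") by the definition
item `defn-IsOfOGradySixType`: "the Looijenga–Lunts–Verbitsky algebra of a HK manifold and
'canonical Hodge class' (`so(H²)`-invariant class)"; the route HodgeConjecture/OG6CharacterSectors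
reasons with the LLV decomposition `H*(OG6) = V_(3) ⊕ V_(1,1,1) ⊕ V^{⊕135} ⊕ ℝ^{⊕240}` of
Green–Kim–Laza–Robles (Thm. 52) and its "240 canonical middle classes" (the trivial summands).

## Sources (read; arXiv text pages)

* E. Looijenga, V. Lunts, *A Lie algebra attached to a projective variety*, Invent. Math. 129 (1997)
  361–412 (arXiv:alg-geom/9604014), §1 (arXiv pp. 3–6), verbatim: `M` a graded `K`-vector space,
  "`h : M → M` the transformation that is multiplication by `k` in degree `k`"; "We say that a
  linear transformation `e : M → M` of degree `2` has the Lefschetz property if for all integers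
  `k ≥ 0`, `eᵏ` maps `M_{-k}` isomorphically onto `M_k`. According to the Jacobson–Morozov lemma this
  is equivalent to the existence of `K`-linear transformation `f` in `M` of degree `-2` such that
  `[e, f] = h`. This `f` is then unique and `(e, h, f)` is a `sl(2)`-triple […] For `a` in this open
  set, we have defined the operator `f_a` such that `(e_a, h, f_a)` is `sl(2)`-triple. […] We let
  `g(a, M)` denote the Lie subalgebra of `gl(M)` generated by the transformations `e_a, f_a`", and
  (1.9): for `X` compact Kähler of dimension `n`, `M = H(X)[n]` as a module over `H²(X)` (cup
  product): "The corresponding semisimple Lie subalgebra of `aut H(X)` will be called the total Lie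
  algebra of `M` and be denoted `g_tot(X)`; it is defined over `ℚ`. […] Clearly, `g_tot(X)` is
  independent of the complex structure."
* M. Green, Y.-J. Kim, R. Laza, C. Robles, *The LLV decomposition of hyper-Kähler cohomology*,
  Math. Ann. 382 (2022) (arXiv:1906.03432), §2.1 (arXiv p. 8): "`[L_ω, Λ_ω] = h`, where `h` is the
  degree operator `h : H*(X, ℚ) → H*(X, ℚ)`, `x ↦ (k - dim X) x` for `x ∈ Hᵏ(X, ℚ)`. It follows that
  `{L_ω, h, Λ_ω}` is an `sl(2)`-triple. The operator `L_x = x ∪ _` is well defined for any cohomology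
  class `x ∈ H²(X)` […] the existence of an operator (automatically unique) `Λ_x` completing
  `{L_x, h}` to an `sl(2)`-triple is an open algebraic condition"; **Definition 13** ([LL97]): "The
  Looijenga–Lunts–Verbitsky (LLV) algebra `g(X)` of `X` is the Lie subalgebra of `gl(H*(X, ℚ))`
  generated by all formal Lefschetz and dual Lefschetz operators `L_x, Λ_x ∈ gl(H*(X, ℚ))`
  associated to almost all elements `x ∈ H²(X, ℚ)`" (footnote: "`g(X)` is called the total Lie
  algebra of `X` in [ll97], and denoted by `g_tot(X)`"); Thm. 14 (Looijenga–Lunts, Verbitsky: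
  `g ≅ so(4, b₂ - 2)` for `X` compact hyper-Kähler); p. 4: "`ℝ^{⊕240}` stands for `240` copies of
  the trivial representation".

## Rendering (tree carriers) and design

Purely cohomological and topological, for ANY topological space `Y`, commutative coefficient ring
`R` and "complex dimension" parameter `N : ℕ` (Looijenga–Lunts' shift `M = H(X)[n]`, `n = N`):

* `totalCohomology R Y = ⨁ₖ Hᵏ(Y; R)` (Mathlib `DirectSum` of the tree's `singularCohomology`), with
  `gl(H*) = Module.End R (totalCohomology R Y)` carrying Mathlib's commutator Lie algebra structure
  (`LieRing.ofAssociativeRing`);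
* `degreeOperator R Y N = h`: multiplication by `k - N` on `Hᵏ` (verbatim GKLR; `= k` on
  `M_k = H^{N+k}`, verbatim LL);
* `totalLefschetz a = L_a = e_a`: `a ⌣ _` on each `Hᵏ → H^{k+2}` (the tree's
  `Geometry.Kaehler.lefschetzOperator`), assembled on the direct sum;
* `IsDualLefschetz N a Λ`: `(L_a, h, Λ)` is an `sl(2)`-triple in `gl(H*)` — Mathlib's
  `IsSl2Triple h e f` (`⁅e, f⁆ = h`, `⁅h, e⁆ = 2e`, `⁅h, f⁆ = -2f`, `h ≠ 0`), i.e. `Λ` is a (the) dual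
  Lefschetz operator `f_a = Λ_a` of `a`; `HasDualLefschetz N a`: some `Λ` exists ("`a` has the
  Lefschetz property", by Jacobson–Morozov, LL p. 4);
* `llvAlgebra R Y N = g_tot`: the Lie subalgebra of `gl(H*(Y; R))` GENERATED (Mathlib
  `LieSubalgebra.lieSpan`) by the operators `L_a` and `Λ` over all pairs with
  `IsDualLefschetz N a Λ` — literally LL's "generated by the transformations `e_a, f_a`" for `a` in
  the Lefschetz locus (GKLR: "associated to almost all `x`");
* `IsLLVTrivial R Y N v`: `v ∈ H*(Y; R)` is annihilated by `g_tot` — it spans a trivial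
  sub-representation (GKLR's trivial summands, the route's "canonical classes"; since `h ∈ g_tot` as
  soon as one Lefschetz class exists, such `v` live in the middle degree `k = N`).

INTENDED INSTANCE: `Y = X(ℂ)` (`Motives.ComplexPoints X`; then `Hᵏ(Y; ℂ)` is the tree's
`HodgeTheory.complexBetti X k`) or a compact Kähler manifold, `N = dim_ℂ X`, `R = ℚ` (LL, GKLR: "defined
over `ℚ`") or `R = ℝ, ℂ` (the same construction after extension of scalars; that
`g_tot(X; ℂ) = g_tot(X; ℚ) ⊗ ℂ` is a theorem — rationality of Jacobson–Morozov — not used here).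
Junk analysis: if NO class has the Lefschetz property (e.g. `Y` not "Kähler-like", or `N` not the
middle dimension) the generating set is empty and `llvAlgebra = ⊥` (LL's `g(a, M)` is then simply not
defined; GKLR: "The Kähler assumption is needed only to conclude that the set of `x ∈ H²(X)` for which
`Λ_x` is defined is a non-empty (and thus dense) open Zariski set"), and every `v` is `IsLLVTrivial`.
Mathlib's `IsSl2Triple` demands `h ≠ 0`, which for `h = degreeOperator` fails only when
`Hᵏ(Y; R) = 0` for all `k ≠ N` (e.g. `Y = ∅`, or a point with `N = 0`) — the degenerate cases in
which LL's `M` has no Lefschetz operators either.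

## API (all proved)

`totalLefschetz_lof`, `degreeOperator_lof` (values on homogeneous elements), `totalLefschetz_add`,
`totalLefschetz_smul` (linearity of `a ↦ L_a`), **`lie_degreeOperator_totalLefschetz`**:
`⁅h, L_a⁆ = 2 • L_a` for EVERY `a` (so `L_a` has degree `2`, and `IsDualLefschetz N a Λ` amounts to
`⁅L_a, Λ⁆ = h`, `⁅h, Λ⁆ = -2Λ`, `h ≠ 0`: `isDualLefschetz_iff`), memberships `totalLefschetz_mem`,
`dual_mem`, `degreeOperator_mem` (`h = ⁅L_a, Λ⁆ ∈ g_tot`), `totalLefschetz_mem_of_mem_span` (`L_b ∈ g_tot`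
for `b` in the `R`-span of the Lefschetz classes — all of `H²` in the Kähler case), and
`IsLLVTrivial.degreeOperator_apply` (a `g_tot`-trivial class is killed by `h` once a Lefschetz class
exists).

## Not here

Jacobson–Morozov (existence of `Λ_a` ⟺ hard Lefschetz for `a`, i.e. the tree's
`Geometry.Kaehler.HasHardLefschetzProperty a N`; uniqueness of `Λ_a`); semisimplicity of `g_tot`;
the theorems `g_tot(X) ≅ so(4, b₂ - 2)` (LL Prop. 4.5, Verbitsky) and the LLV decompositions of the
known hyper-Kähler types (GKLR Thms. 1–3, Thm. 52 for OG6); the reduced algebra `ḡ ≅ so(H², q)` and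
its relation to the Beauville–Bogomolov form (`BeauvilleBogomolovForm.lean`).
-/

noncomputable section

open DirectSum
open Literature.AlgebraicTopology.SingularHomology
open Literature.Geometry.Kaehler

universe u v

namespace Literature.AlgebraicGeometry.Hyperkaehler

-- Mathlib's idiom for the commutator bracket `⁅f, g⁆ = f * g - g * f` on an associative ring
-- (here `gl(H*) = Module.End R _`): `LieRing.ofAssociativeRing` is a `def` activated locally
-- (Mathlib.Algebra.Lie.OfAssociative, `attribute [local instance 100]`), never a global instance.
attribute [local instance 100] LieRing.ofAssociativeRing

variable (R : Type v) [CommRing R] (Y : Type u) [TopologicalSpace Y]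

/-! ### Total cohomology and its general linear Lie algebra -/

/-- The **total cohomology** `H*(Y; R) = ⨁ₖ Hᵏ(Y; R)` (direct sum over all degrees `k : ℕ` of the
tree's singular cohomology), an `R`-module; `gl(H*(Y; R))` is `Module.End R (totalCohomology R Y)`
with the commutator bracket. Looijenga–Lunts' `M = H(X)[n]` is this module with the grading shifted
by `n` (the shift is carried by `degreeOperator`). [cite: LooijengaLunts1997, §1 (1.9)] -/
abbrev totalCohomology : Type (max u v) :=
  ⨁ k : ℕ, singularCohomology R R Y k

/-- The inclusion `Hᵏ(Y; R) → H*(Y; R)` of the degree-`k` summand (Mathlib `DirectSum.lof`).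
[cite: LooijengaLunts1997, §1] -/
abbrev ofDegree (k : ℕ) : singularCohomology R R Y k →ₗ[R] totalCohomology R Y :=
  lof R ℕ (fun k ↦ singularCohomology R R Y k) k

/-! ### The degree operator `h` and the Lefschetz operators `L_a` on `H*` -/

/-- The **degree operator** `h ∈ gl(H*(Y; R))` for "complex dimension" `N`: multiplication by
`k - N` on `Hᵏ(Y; R)` (GKLR (2.1): "`x ↦ (k - dim X) x` for `x ∈ Hᵏ`"; Looijenga–Lunts:
multiplication by `k` on `M_k = H^{N+k}`). [cite: GreenKimLazaRobles2022, §2.1 (the degree operator h)]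
[cite: LooijengaLunts1997, §1 p. 3] -/
def degreeOperator (N : ℕ) : Module.End R (totalCohomology R Y) :=
  toModule R ℕ (totalCohomology R Y) fun k ↦ ((k : R) - N) • ofDegree R Y k

variable {R Y}

/-- `h` multiplies a homogeneous class of degree `k` by `k - N`. [cite: GreenKimLazaRobles2022, §2.1] -/
@[simp]
theorem degreeOperator_lof (N k : ℕ) (x : singularCohomology R R Y k) :
    degreeOperator R Y N (ofDegree R Y k x) = ((k : R) - N) • ofDegree R Y k x := by
  simp only [degreeOperator, toModule_lof, LinearMap.smul_apply]

/-- The **(formal) Lefschetz operator** `L_a = a ⌣ _ ∈ gl(H*(Y; R))` of a class `a ∈ H²(Y; R)`: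
on each summand the tree's `lefschetzOperator a : Hᵏ → H^{k+2}` (cup product on the left), assembled
on the direct sum (LL: `e_a`; GKLR: "`L_x = x ∪ _` is well defined for any cohomology class
`x ∈ H²(X)`"). [cite: LooijengaLunts1997, §1 p. 4] [cite: GreenKimLazaRobles2022, §2.1] -/
def totalLefschetz (a : singularCohomology R R Y 2) : Module.End R (totalCohomology R Y) :=
  toModule R ℕ (totalCohomology R Y) fun k ↦
    ofDegree R Y (k + 2) ∘ₗ lefschetzOperator a (Nat.add_comm 2 k)

/-- `L_a` sends a homogeneous class `x ∈ Hᵏ` to `a ⌣ x ∈ H^{k+2}`. [cite: LooijengaLunts1997, §1 p. 4] -/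
@[simp]
theorem totalLefschetz_lof (a : singularCohomology R R Y 2) (k : ℕ) (x : singularCohomology R R Y k) :
    totalLefschetz a (ofDegree R Y k x) =
      ofDegree R Y (k + 2) (lefschetzOperator a (Nat.add_comm 2 k) x) := by
  simp only [totalLefschetz, toModule_lof, LinearMap.coe_comp, Function.comp_apply]

/-- `a ↦ L_a` is additive (`⌣` is bilinear). [cite: LooijengaLunts1997, §1 p. 4] -/
theorem totalLefschetz_add (a b : singularCohomology R R Y 2) :
    totalLefschetz (a + b) = totalLefschetz a + totalLefschetz b := by
  refine linearMap_ext R fun k ↦ LinearMap.ext fun x ↦ ?_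
  simp only [LinearMap.coe_comp, Function.comp_apply, LinearMap.add_apply, totalLefschetz_lof,
    lefschetzOperator_apply, map_add]

/-- `a ↦ L_a` is `R`-homogeneous (`⌣` is bilinear). [cite: LooijengaLunts1997, §1 p. 4] -/
theorem totalLefschetz_smul (c : R) (a : singularCohomology R R Y 2) :
    totalLefschetz (c • a) = c • totalLefschetz a := by
  refine linearMap_ext R fun k ↦ LinearMap.ext fun x ↦ ?_
  simp only [LinearMap.coe_comp, Function.comp_apply, LinearMap.smul_apply, totalLefschetz_lof,
    lefschetzOperator_apply, map_smul]

/-- **`L_a` has degree `2`**: `⁅h, L_a⁆ = 2 • L_a` in `gl(H*(Y; R))`, for every `a ∈ H²(Y; R)` and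
every `N` (on `Hᵏ`: `((k + 2 - N) - (k - N)) L_a = 2 L_a`). This is the relation `[h, e] = 2e` of the
`sl(2)`-triples of Looijenga–Lunts, which therefore holds unconditionally.
[cite: LooijengaLunts1997, §1 p. 4] [cite: GreenKimLazaRobles2022, §2.1] -/
theorem lie_degreeOperator_totalLefschetz (N : ℕ) (a : singularCohomology R R Y 2) :
    ⁅degreeOperator R Y N, totalLefschetz a⁆ = 2 • totalLefschetz a := by
  refine linearMap_ext R fun k ↦ LinearMap.ext fun x ↦ ?_
  simp only [LinearMap.coe_comp, Function.comp_apply, Ring.lie_def, LinearMap.sub_apply,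
    Module.End.mul_apply, LinearMap.smul_apply, totalLefschetz_lof, degreeOperator_lof, map_smul]
  rw [← sub_smul]
  have h2 : ((k + 2 : ℕ) : R) - N - ((k : R) - N) = 2 := by
    push_cast
    ring
  rw [h2, two_smul, two_smul]

/-! ### Dual Lefschetz operators and the LLV algebra -/

/-- **`Λ` is a dual Lefschetz operator of `a`** (in "complex dimension" `N`): `(L_a, h, Λ)` is an
`sl(2)`-triple in `gl(H*(Y; R))` — Mathlib's `IsSl2Triple h e f`: `⁅L_a, Λ⁆ = h`, `⁅h, L_a⁆ = 2L_a`,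
`⁅h, Λ⁆ = -2Λ` (and `h ≠ 0`). LL: "the operator `f_a` such that `(e_a, h, f_a)` is `sl(2)`-triple";
GKLR: "`Λ_x` completing `{L_x, h}` to an `sl(2)`-triple" (unique when it exists).
[cite: LooijengaLunts1997, §1 p. 4] [cite: GreenKimLazaRobles2022, §2.1] -/
def IsDualLefschetz (N : ℕ) (a : singularCohomology R R Y 2)
    (Λ : Module.End R (totalCohomology R Y)) : Prop :=
  IsSl2Triple (degreeOperator R Y N) (totalLefschetz a) Λ

/-- **`a` has the Lefschetz property** (in "complex dimension" `N`): a dual Lefschetz operator `Λ_a`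
exists (LL, p. 4: by Jacobson–Morozov equivalent to `L_aᵏ : H^{N-k} ≅ H^{N+k}` for all `k`, the
tree's `Geometry.Kaehler.HasHardLefschetzProperty a N` — an equivalence not proved here).
[cite: LooijengaLunts1997, §1 p. 4] -/
def HasDualLefschetz (N : ℕ) (a : singularCohomology R R Y 2) : Prop :=
  ∃ Λ : Module.End R (totalCohomology R Y), IsDualLefschetz N a Λ

/-- Since `⁅h, L_a⁆ = 2L_a` always holds, `Λ` is dual Lefschetz to `a` iff `h ≠ 0`, `⁅L_a, Λ⁆ = h` and
`⁅h, Λ⁆ = -2Λ`. [cite: LooijengaLunts1997, §1 p. 4] -/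
theorem isDualLefschetz_iff (N : ℕ) (a : singularCohomology R R Y 2)
    (Λ : Module.End R (totalCohomology R Y)) :
    IsDualLefschetz N a Λ ↔ degreeOperator R Y N ≠ 0 ∧ ⁅totalLefschetz a, Λ⁆ = degreeOperator R Y N ∧
      ⁅degreeOperator R Y N, Λ⁆ = -(2 • Λ) := by
  constructor
  · intro h
    exact ⟨h.h_ne_zero, h.lie_e_f, h.lie_h_f_nsmul⟩
  · rintro ⟨h0, hef, hhf⟩
    exact ⟨h0, hef, lie_degreeOperator_totalLefschetz N a, hhf⟩

variable (R Y) in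
/-- **The Looijenga–Lunts–Verbitsky (total) Lie algebra `g_tot(Y; R)`** in "complex dimension" `N`:
the Lie subalgebra of `gl(H*(Y; R))` generated by the Lefschetz operators `L_a` and the dual
Lefschetz operators `Λ` over all `sl(2)`-triples `(L_a, h, Λ)`, `a ∈ H²(Y; R)` (LL §1: "`g(a, M)`
denote[s] the Lie subalgebra of `gl(M)` generated by the transformations `e_a, f_a`", with
`a = H²(X)`, `M = H(X)[N]`: "the total Lie algebra `g_tot(X)`"; GKLR Def. 13: "generated by all
formal Lefschetz and dual Lefschetz operators `L_x, Λ_x` associated to almost all `x ∈ H²(X, ℚ)`").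
For `X` compact hyper-Kähler, `g_tot ≅ so(4, b₂ - 2)` (GKLR Thm. 14, not proved here). Junk: `⊥` if
no class has the Lefschetz property (module docstring). [cite: LooijengaLunts1997, §1 p. 4 and (1.9)]
[cite: GreenKimLazaRobles2022, §2.1 Def. 13] -/
def llvAlgebra (N : ℕ) : LieSubalgebra R (Module.End R (totalCohomology R Y)) :=
  LieSubalgebra.lieSpan R (Module.End R (totalCohomology R Y))
    {E | ∃ (a : singularCohomology R R Y 2) (Λ : Module.End R (totalCohomology R Y)),
      IsDualLefschetz N a Λ ∧ (E = totalLefschetz a ∨ E = Λ)}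

/-- The Lefschetz operator of a class with the Lefschetz property lies in `g_tot`.
[cite: LooijengaLunts1997, §1 p. 4] -/
theorem totalLefschetz_mem {N : ℕ} {a : singularCohomology R R Y 2}
    {Λ : Module.End R (totalCohomology R Y)} (h : IsDualLefschetz N a Λ) :
    totalLefschetz a ∈ llvAlgebra R Y N :=
  LieSubalgebra.subset_lieSpan ⟨a, Λ, h, Or.inl rfl⟩

/-- A dual Lefschetz operator lies in `g_tot`. [cite: LooijengaLunts1997, §1 p. 4] -/
theorem dual_mem {N : ℕ} {a : singularCohomology R R Y 2}
    {Λ : Module.End R (totalCohomology R Y)} (h : IsDualLefschetz N a Λ) :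
    Λ ∈ llvAlgebra R Y N :=
  LieSubalgebra.subset_lieSpan ⟨a, Λ, h, Or.inr rfl⟩

/-- The degree operator `h = ⁅L_a, Λ_a⁆` lies in `g_tot` as soon as one class has the Lefschetz
property (GKLR: "the `1`-dimensional center `z(g₀)` is spanned by the degree operator `h`").
[cite: GreenKimLazaRobles2022, §2.1.1] -/
theorem degreeOperator_mem {N : ℕ} {a : singularCohomology R R Y 2}
    {Λ : Module.End R (totalCohomology R Y)} (h : IsDualLefschetz N a Λ) :
    degreeOperator R Y N ∈ llvAlgebra R Y N := by
  rw [← h.lie_e_f]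
  exact (llvAlgebra R Y N).lie_mem (totalLefschetz_mem h) (dual_mem h)

/-- `L_b ∈ g_tot` for every `b` in the `R`-span of the classes having the Lefschetz property (`a ↦ L_a`
is linear); for `X` compact Kähler these span `H²(X)` (a non-empty Zariski-open set), so ALL `L_b`
belong to `g_tot`, as in GKLR Def. 13. [cite: GreenKimLazaRobles2022, §2.1 Def. 13] -/
theorem totalLefschetz_mem_of_mem_span {N : ℕ} {b : singularCohomology R R Y 2}
    (hb : b ∈ Submodule.span R {a : singularCohomology R R Y 2 | HasDualLefschetz N a}) :
    totalLefschetz b ∈ llvAlgebra R Y N := by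
  induction hb using Submodule.span_induction with
  | mem a ha =>
    obtain ⟨Λ, hΛ⟩ := ha
    exact totalLefschetz_mem hΛ
  | zero =>
    have h0 : totalLefschetz (0 : singularCohomology R R Y 2) = 0 := by
      simpa using totalLefschetz_smul (0 : R) (0 : singularCohomology R R Y 2)
    rw [h0]
    exact (llvAlgebra R Y N).zero_mem
  | add a a' _ _ ha ha' =>
    rw [totalLefschetz_add]
    exact (llvAlgebra R Y N).add_mem ha ha'
  | smul c a _ ha =>
    rw [totalLefschetz_smul]
    exact (llvAlgebra R Y N).smul_mem c ha

/-! ### Trivial sub-representations ("canonical classes") -/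

variable (R Y) in
/-- **`v ∈ H*(Y; R)` is `g_tot`-trivial**: every operator of the LLV algebra kills `v`, i.e. `R ∙ v`
is a trivial sub-representation of `H*(Y; R)` (GKLR: the summands "`ℝ^{⊕240}` stands for `240`
copies of the trivial representation" of `H*(OG6)`; the "canonical classes" of route
HodgeConjecture/OG6CharacterSectors). [cite: GreenKimLazaRobles2022, §1 (Thm. 3) and §2.1] -/
def IsLLVTrivial (N : ℕ) (v : totalCohomology R Y) : Prop :=
  ∀ E ∈ llvAlgebra R Y N, E v = 0

/-- A `g_tot`-trivial class is killed by the degree operator as soon as some class has the Lefschetz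
property (`h ∈ g_tot`); i.e. it is concentrated in the middle degree `k = N` whenever `k - N` is a
non-zero-divisor on `Hᵏ`. [cite: GreenKimLazaRobles2022, §2.1.1] -/
theorem IsLLVTrivial.degreeOperator_apply {N : ℕ} {v : totalCohomology R Y} (hv : IsLLVTrivial R Y N v)
    {a : singularCohomology R R Y 2} {Λ : Module.End R (totalCohomology R Y)}
    (h : IsDualLefschetz N a Λ) : degreeOperator R Y N v = 0 :=
  hv _ (degreeOperator_mem h)

/-- `0` is `g_tot`-trivial. [folklore] -/
theorem isLLVTrivial_zero (N : ℕ) : IsLLVTrivial R Y N 0 := fun E _ ↦ map_zero E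

/-- The `g_tot`-trivial classes form an `R`-submodule of `H*(Y; R)` (the isotypic component of the
trivial representation). [cite: GreenKimLazaRobles2022, §1 (Thm. 3)] -/
def llvTrivialSubmodule (N : ℕ) : Submodule R (totalCohomology R Y) where
  carrier := {v | IsLLVTrivial R Y N v}
  zero_mem' := isLLVTrivial_zero N
  add_mem' {v w} hv hw := fun E hE ↦ by rw [map_add, hv E hE, hw E hE, add_zero]
  smul_mem' c {v} hv := fun E hE ↦ by rw [map_smul, hv E hE, smul_zero]

/-- Membership in `llvTrivialSubmodule`. [folklore] -/
@[simp]
theorem mem_llvTrivialSubmodule_iff (N : ℕ) (v : totalCohomology R Y) :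
    v ∈ llvTrivialSubmodule (R := R) (Y := Y) N ↔ IsLLVTrivial R Y N v :=
  Iff.rfl

end Literature.AlgebraicGeometry.Hyperkaehler

end
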